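import Summits.MatrixMultiplication.MatrixMultiplication.Theorems.SoloBlindTopLayer
import Summits.MatrixMultiplication.MatrixMultiplication.Theorems.SoloBlindOlsonBerman

set_option linter.dupNamespace false

/-!
# The top layer, unconditionally: Olson's bound discharges the maximality hypothesis

Sub-programme (K₃) / Conjecture H♯, HOME `paper/KraftK3.md` K3.26–K3.27 (s82–s83).  In
`SoloBlindTopLayer` the TOP-LAYER THEOREM (every 2-colouring of `S` is good for `σ`, hence H♯ ⟺ E at
`(S, σ)`) was derived from FULLNESS `Σ⁰(S) ∪ (σ + Σ⁰(S)) = G`, and fullness from an abstract maximality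
hypothesis `hmax` ("every one-element extension of the family `S·σ` has a zero sub-sum").  Here that
hypothesis is DISCHARGED for `G = 𝔽₃^r` by Olson's theorem `D(𝔽₃^r) ≤ 2r + 1`, which is in the tree as
`soloBlindOB_olson_bound` (`SoloBlindOlsonBerman`): a zero-sum-free sequence in `𝔽₃^r` has length `≤ 2r`.

* `soloBlindTLO_zsf_insertNone` — one-element extensions: if `S` is zero-sum free for `f` and
  `x + Σ_T f ≠ 0` for all `T ⊆ S`, the extended family `S·x` (realised over `insertNone S ⊆ Option κ`)
  is zero-sum free.
* `soloBlindTLO_card_le` — Olson's bound in Finset form (any index type).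
* `soloBlindTLO_card_succ_le` — THE TOP LAYER IS THE LAST LAYER WITH TARGETS: if `S` is zero-sum free
  and `σ` is H-good (`σ + Σ_T ≠ 0` for all `T ⊆ S`) then `|S| + 1 ≤ 2r`.
* `soloBlindTLO_full` — for `|S| ≥ 2r - 1` and `σ` H-good, `(S, σ)` is FULL (the family `S·σ·(-g)` would
  otherwise be zero-sum free of length `2r + 1`).
* `soloBlindTLO_allGood`, `soloBlindTLO_goodColourings_eq_powerset`, `soloBlindTLO_hsharp_iff_conjE` —
  THEOREM TL unconditionally: on the top layer `|S| = 2r - 1` of `𝔽₃^r` every colouring is good and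
  Conjecture H♯ at `(S, σ)` is equivalent to Conjecture E there (`K(σ; S) ≤ 1/2`).
* `soloBlindTLO_cosym` — CO-SYMMETRY of the top layer: `Σ⁰(S) ∪ -Σ⁰(S) = 𝔽₃^r` (no antipodal pair of
  holes), so the H-good targets of a top-layer `S` are exactly the negatives of its holes.
Exhaustive companion data (s83, `work/tri/s83/maxclass.py`): the maximum zero-sum-free sets of `𝔽₃^4`
(478 651 680 of them) form exactly 28 orbits under `GL₄(𝔽₃)`, the top-layer 7-sets 36 orbits, the pairs
`(S, σ)` 181 orbits; the largest Kraft mass is `1/2` (Conjecture E holds with equality somewhere on every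
top-layer `S`).  No `sorry`, standard axioms.
-/

namespace Summit.MatrixMultiplication.MatrixMultiplication.Theorems

open Finset

section TopLayerOlson

variable {r : ℕ}

/-- In `𝔽₃^r` every element has additive order dividing `3`. -/
theorem soloBlindTLO_three (g : Fin r → ZMod 3) : g + g + g = 0 := by
  funext i
  simp only [Pi.add_apply, Pi.zero_apply]
  generalize g i = x
  decide +revert

/-- ONE-ELEMENT EXTENSION.  If `S` is zero-sum free for `f` and `x + Σ_T f ≠ 0` for every `T ⊆ S`, then
the family `S·x`, realised on `Option κ` (`none ↦ x`, `some i ↦ f i`) over `insertNone S`, is zero-sum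
free. -/
theorem soloBlindTLO_zsf_insertNone {κ : Type*} {G : Type*} [AddCommGroup G] (f : κ → G) (x : G)
    (S : Finset κ) (zsf : ∀ T ⊆ S, T.Nonempty → ∑ i ∈ T, f i ≠ 0)
    (hx : ∀ T ⊆ S, x + ∑ i ∈ T, f i ≠ 0) :
    ∀ T ⊆ insertNone S, T.Nonempty → ∑ o ∈ T, o.elim x f ≠ 0 := by
  classical
  intro T hT hne
  have hsub : eraseNone T ⊆ S := fun i hi => some_mem_insertNone.mp (hT (mem_eraseNone.mp hi))
  by_cases hn : none ∈ T
  · have hTeq : T = insertNone (eraseNone T) := by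
      rw [insertNone_eraseNone, insert_eq_of_mem hn]
    rw [hTeq, sum_insertNone]
    simpa only [Option.elim_none, Option.elim_some] using hx _ hsub
  · have hTeq : T = (eraseNone T).map Function.Embedding.some := by
      rw [map_some_eraseNone, erase_eq_of_notMem hn]
    rw [hTeq, sum_map]
    have hne' : (eraseNone T).Nonempty := by
      obtain ⟨o, ho⟩ := hne
      cases o with
      | none => exact absurd ho hn
      | some i => exact ⟨i, mem_eraseNone.mpr ho⟩
    simpa only [Function.Embedding.some_apply, Option.elim_some] using zsf _ hsub hne'

/-- OLSON'S BOUND, FINSET FORM: a zero-sum-free finite family in `𝔽₃^r` has at most `2r` members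
(from `soloBlindOB_olson_bound`, by enumerating `S` with `Finset.equivFin`). -/
theorem soloBlindTLO_card_le {κ : Type*} (f : κ → (Fin r → ZMod 3)) (S : Finset κ)
    (zsf : ∀ T ⊆ S, T.Nonempty → ∑ i ∈ T, f i ≠ 0) : S.card ≤ 2 * r := by
  classical
  let emb : Fin S.card ↪ κ :=
    ⟨fun k => ((S.equivFin.symm k : S) : κ),
      fun k l hkl => S.equivFin.symm.injective (Subtype.ext hkl)⟩
  refine soloBlindOB_olson_bound (fun k => f (emb k)) ?_
  intro T hT
  have hsub : T.map emb ⊆ S := by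
    intro y hy
    obtain ⟨k, -, rfl⟩ := mem_map.mp hy
    exact (S.equivFin.symm k).2
  have h0 := zsf (T.map emb) hsub (map_nonempty.mpr hT)
  rwa [sum_map] at h0

/-- THE TOP LAYER IS THE LAST LAYER WITH TARGETS.  If `S` is zero-sum free in `𝔽₃^r` and `σ` is H-good
for `S` (`σ + Σ_T ≠ 0` for all `T ⊆ S`, i.e. the family `S·σ` is zero-sum free), then `|S| + 1 ≤ 2r`:
at `|S| = 2r` there is no H-good target, and `|S| = 2r - 1` is the top layer. -/
theorem soloBlindTLO_card_succ_le {ι : Type*} (h : ι → (Fin r → ZMod 3)) (S : Finset ι)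
    (σ : Fin r → ZMod 3) (zsf : ∀ T ⊆ S, T.Nonempty → ∑ i ∈ T, h i ≠ 0)
    (hσ : ∀ T ⊆ S, σ + ∑ i ∈ T, h i ≠ 0) : S.card + 1 ≤ 2 * r := by
  have h0 := soloBlindTLO_card_le (fun o : Option ι => o.elim σ h) (insertNone S)
    (soloBlindTLO_zsf_insertNone h σ S zsf hσ)
  rwa [card_insertNone] at h0

/-- FULLNESS ON THE TOP LAYER (the hypothesis `hmax` of `soloBlind_full_of_maximal` discharged by
Olson's bound).  If `S` is zero-sum free in `𝔽₃^r` with `|S| + 1 ≥ 2r` and `σ` is H-good, then every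
`g` is `Σ_V` or `σ + Σ_V` for some `V ⊆ S`: otherwise `S·σ·(-g)` would be a zero-sum-free family with
`2r + 1` members. -/
theorem soloBlindTLO_full {ι : Type*} (h : ι → (Fin r → ZMod 3)) (S : Finset ι)
    (σ : Fin r → ZMod 3) (hcard : 2 * r ≤ S.card + 1)
    (zsf : ∀ T ⊆ S, T.Nonempty → ∑ i ∈ T, h i ≠ 0) (hσ : ∀ T ⊆ S, σ + ∑ i ∈ T, h i ≠ 0) :
    soloBlindFull h S σ := by
  classical
  intro g
  by_contra hcon
  push Not at hcon
  have zsf1 := soloBlindTLO_zsf_insertNone h σ S zsf hσ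
  have hg : ∀ T ⊆ insertNone S, -g + ∑ o ∈ T, o.elim σ h ≠ 0 := by
    intro T hT
    have hsub : eraseNone T ⊆ S := fun i hi => some_mem_insertNone.mp (hT (mem_eraseNone.mp hi))
    by_cases hn : none ∈ T
    · have hTeq : T = insertNone (eraseNone T) := by
        rw [insertNone_eraseNone, insert_eq_of_mem hn]
      rw [hTeq, sum_insertNone]
      simp only [Option.elim_none, Option.elim_some]
      intro h0
      exact (hcon _ hsub).2 (neg_add_eq_zero.mp h0).symm
    · have hTeq : T = (eraseNone T).map Function.Embedding.some := by
        rw [map_some_eraseNone, erase_eq_of_notMem hn]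
      rw [hTeq, sum_map]
      simp only [Function.Embedding.some_apply, Option.elim_some]
      intro h0
      exact (hcon _ hsub).1 (neg_add_eq_zero.mp h0).symm
  have zsf2 := soloBlindTLO_zsf_insertNone (fun o : Option ι => o.elim σ h) (-g) (insertNone S)
    zsf1 hg
  have hle := soloBlindTLO_card_le _ _ zsf2
  rw [card_insertNone, card_insertNone] at hle
  omega

/-- THEOREM TL (i), unconditional: on the top layer of `𝔽₃^r` (`S` zero-sum free, `|S| + 1 ≥ 2r`,
`σ` H-good) EVERY colouring `U ⊆ S` is good for `σ`. -/
theorem soloBlindTLO_allGood {ι : Type*} [DecidableEq ι] (h : ι → (Fin r → ZMod 3)) (S : Finset ι)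
    (σ : Fin r → ZMod 3) (hcard : 2 * r ≤ S.card + 1)
    (zsf : ∀ T ⊆ S, T.Nonempty → ∑ i ∈ T, h i ≠ 0) (hσ : ∀ T ⊆ S, σ + ∑ i ∈ T, h i ≠ 0)
    {U : Finset ι} (hU : U ⊆ S) : U ∈ soloBlindGoodColourings h S σ :=
  soloBlind_allGood_of_full soloBlindTLO_three (soloBlindTLO_full h S σ hcard zsf hσ) hU

/-- THEOREM TL (ii), unconditional: on the top layer the good colourings are the whole power set. -/
theorem soloBlindTLO_goodColourings_eq_powerset {ι : Type*} [DecidableEq ι]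
    (h : ι → (Fin r → ZMod 3)) (S : Finset ι) (σ : Fin r → ZMod 3) (hcard : 2 * r ≤ S.card + 1)
    (zsf : ∀ T ⊆ S, T.Nonempty → ∑ i ∈ T, h i ≠ 0) (hσ : ∀ T ⊆ S, σ + ∑ i ∈ T, h i ≠ 0) :
    soloBlindGoodColourings h S σ = S.powerset :=
  soloBlind_goodColourings_eq_powerset_of_full soloBlindTLO_three
    (soloBlindTLO_full h S σ hcard zsf hσ)

/-- THEOREM TL (iii), unconditional: on the top layer of `𝔽₃^r` Conjecture H♯ at `(S, σ)` holds iff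
Conjecture E does (`K(σ; S) ≤ 1/2`). -/
theorem soloBlindTLO_hsharp_iff_conjE {ι : Type*} [DecidableEq ι] (h : ι → (Fin r → ZMod 3))
    (S : Finset ι) (σ : Fin r → ZMod 3) (hcard : 2 * r ≤ S.card + 1)
    (zsf : ∀ T ⊆ S, T.Nonempty → ∑ i ∈ T, h i ≠ 0) (hσ : ∀ T ⊆ S, σ + ∑ i ∈ T, h i ≠ 0) :
    soloBlindHSharp h S σ ↔ soloBlindMass h S σ ≤ 1 / 2 :=
  soloBlind_hsharp_iff_conjE_of_full soloBlindTLO_three (soloBlindTLO_full h S σ hcard zsf hσ)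

/-- CO-SYMMETRY OF THE TOP LAYER: if `S` is zero-sum free in `𝔽₃^r` with `|S| + 1 ≥ 2r`, then for
every `g` one of `g`, `-g` is a subset sum of `S` (`Σ⁰(S) ∪ -Σ⁰(S) = 𝔽₃^r`): a hole `g` with `-g` a hole
would make `S·g` zero-sum free, hence FULL, and fullness at `u = 0` puts `g` or `-g` into `Σ⁰(S)`.
Consequently the H-good targets of a top-layer `S` are exactly the negatives of its holes. -/
theorem soloBlindTLO_cosym {ι : Type*} (h : ι → (Fin r → ZMod 3)) (S : Finset ι)
    (hcard : 2 * r ≤ S.card + 1) (zsf : ∀ T ⊆ S, T.Nonempty → ∑ i ∈ T, h i ≠ 0)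
    (g : Fin r → ZMod 3) :
    (∃ V ⊆ S, ∑ i ∈ V, h i = g) ∨ (∃ V ⊆ S, ∑ i ∈ V, h i = -g) := by
  by_contra hcon
  push Not at hcon
  have hg : ∀ T ⊆ S, g + ∑ i ∈ T, h i ≠ 0 := by
    intro T hT h0
    exact hcon.2 T hT (neg_eq_of_add_eq_zero_right h0).symm
  have hfull := soloBlindTLO_full h S g hcard zsf hg
  rcases soloBlind_thick_of_full soloBlindTLO_three hfull 0 with ⟨V, hV, h1⟩ | ⟨V, hV, h2⟩
  · exact hcon.2 V hV (by rw [h1, zero_sub])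
  · exact hcon.1 V hV (by rw [h2, zero_add])

/-- On the top layer an H-good target is automatically a subset sum: `-σ ∉ Σ⁰(S)` forces `σ ∈ Σ⁰(S)`. -/
theorem soloBlindTLO_target_mem_sums {ι : Type*} (h : ι → (Fin r → ZMod 3)) (S : Finset ι)
    (σ : Fin r → ZMod 3) (hcard : 2 * r ≤ S.card + 1)
    (zsf : ∀ T ⊆ S, T.Nonempty → ∑ i ∈ T, h i ≠ 0) (hσ : ∀ T ⊆ S, σ + ∑ i ∈ T, h i ≠ 0) :
    ∃ V ⊆ S, ∑ i ∈ V, h i = σ := by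
  rcases soloBlindTLO_cosym h S hcard zsf σ with hV | ⟨V, hV, hneg⟩
  · exact hV
  · exact absurd (by rw [hneg, add_neg_cancel]) (hσ V hV)

end TopLayerOlson

end Summit.MatrixMultiplication.MatrixMultiplication.Theorems
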